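import Literature.InformationTheory.QuantumCodes.ToricCodePhenomenological
import Literature.InformationTheory.QuantumCodes.ToricCodeCycles
import Literature.InformationTheory.QuantumCodes.MinWeightDecodingClustersFintype
import Summits.Ventures.QEC.Thresholds.ToricCodePhenomenologicalThresholds
import Summits.Ventures.QEC.Thresholds.ToricCodeClusterThreshold
import Mathlib.Algebra.Module.Submodule.Map
import Mathlib.Analysis.SpecificLimits.Normed
import HarnessLib

/-!
# The space-time complex of the toric memory experiment: projection of closed histories, the
# harmless subspace, space-time distance `≥ L`, and the degree `≤ 10` of its check graph

Venture QEC, `Summits/Ventures/QEC/Thresholds/` (qec-lead D1). Inputs of the UNCONDITIONAL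
cluster-route threshold for the toric code with noisy syndrome measurement
(`ToricCodePhenomenologicalCluster.lean`) — and equally of the future discharge of the DKLP named fact
`ToricCode.phenomThreshold_of_sawCountBound` — all PROVED here (kernel axioms, no named fact):
* `syn_proj_eq_sum_stSyn` / `proj_mem_cycles_of_mem_stCycles`: summing the space-time boundary of a
  history over a site column gives the boundary of its projection, so CLOSED HISTORIES PROJECT TO
  CYCLES of the toric code; `hammingNorm_proj_le`: `|Π(E)| ≤ |E|`;
* `projLin`, `stHarmless` (= `stTrivial` as a `Submodule`: the preimage of the plaquette boundaries
  under `Π`), `mem_stHarmless_iff`;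
* `le_hammingNorm_of_stCycles`: a closed history with homologically non-trivial projection has
  `≥ L` links (DKLP: "at least `L` horizontal links"), from qec-lit-2's `ToricCode.cycle_weight_ge_holds`;
* `degree_stGraph_le`: the check graph of `stMatrix L T` has degree `≤ 10` (row weight `≤ 6`: a site
  lies on `≤ 4` links of its slice and `≤ 2` vertical links; column weight `≤ 2`), via lit-2's
  `degree_checkGraph_le`.
No Monte Carlo number appears here.

## References

* [DennisEtAl2002] Dennis–Kitaev–Landahl–Preskill, J. Math. Phys. 43 (2002) 4452, §4.2–4.3, §5.2
  ("at least `L` horizontal links").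
* [Gottesman2014] D. Gottesman, Quantum Inf. Comput. 14 (2014) 1338, §4 Thm. 3 and Thm. 4 (syndrome
  errors: the same cluster argument on the space-time complex).
* [KovalevPryadko2013] A. A. Kovalev, L. P. Pryadko, Phys. Rev. A 87 (2013) 020304(R), Thm. 3.
-/

noncomputable section

namespace Summit.Ventures.QEC.Thresholds

open Filter Topology Finset Matrix
open Literature.InformationTheory.QuantumCodes
open Literature.InformationTheory.QuantumCodes.ToricCode
open Literature.Probability.LatticeModels
open Literature.Probability.RandomPlanarGeometry

namespace PhenomCluster

variable {L T : ℕ}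

/-! ### Projection lemmas: closed histories project to cycles of weight at most their own -/

/-- The star syndrome is additive over finite sums of chains (linearity of `H^X`).
[cite: DennisEtAl2002, §4.3 (∂ is linear)] -/
theorem syn_sum [NeZero L] {ι : Type*} (s : Finset ι) (f : ι → Chain L) :
    syn L (∑ i ∈ s, f i) = ∑ i ∈ s, syn L (f i) := by
  classical
  induction s using Finset.induction_on with
  | empty => simp [syn]
  | insert a s ha ih =>
    rw [Finset.sum_insert ha, Finset.sum_insert ha, ← ih]
    simp [syn, Matrix.mulVec_add]

/-- **The projection of a closed history is a cycle**: summing the space-time boundary over the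
`T+1` slices of a site column counts every horizontal contribution once and every measurement-error
link twice, so `Σ_τ ∂E(s,τ) = ∂Π(E)(s)`; hence `∂E = 0 ⟹ ∂Π(E) = 0` ("closed world lines … the
projected chain"). [cite: DennisEtAl2002, §4.3 and §6.1 (projection Π of a closed history)] -/
theorem syn_proj_eq_sum_stSyn [NeZero L] (E : History L T) (s : Vertex L) :
    syn L E.proj s = ∑ τ : Fin (T + 1), stSyn L T E (s, τ) := by
  classical
  simp only [stSyn_apply, Finset.sum_add_distrib]
  -- horizontal part: each slice `t` is hit by exactly one `τ` (namely `castSucc t`)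
  have hhor : (∑ τ : Fin (T + 1), ∑ t : Fin T, if τ = t.castSucc then syn L (E.slice t) s else 0) =
      ∑ t : Fin T, syn L (E.slice t) s := by
    rw [Finset.sum_comm]
    refine Finset.sum_congr rfl fun t _ => ?_
    rw [Finset.sum_ite_eq' Finset.univ t.castSucc]
    simp
  -- vertical part: each link `t` is hit by exactly the two slices `castSucc t ≠ succ t`: `m + m = 0`
  have hver : (∑ τ : Fin (T + 1), ∑ t : Fin T,
      if τ = t.castSucc ∨ τ = t.succ then E.meas t s else 0) = 0 := by
    rw [Finset.sum_comm]
    refine Finset.sum_eq_zero fun t _ => ?_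
    have hne : t.castSucc ≠ t.succ := ne_of_lt Fin.castSucc_lt_succ
    have hset : (univ.filter fun τ : Fin (T + 1) => τ = t.castSucc ∨ τ = t.succ) =
        {t.castSucc, t.succ} := by
      ext τ; simp
    rw [← Finset.sum_filter, hset, Finset.sum_pair hne]
    generalize E.meas t s = a
    revert a; decide
  rw [hhor, hver, add_zero, History.proj, syn_sum]
  simp only [Finset.sum_apply]

/-- `∂E = 0 ⟹ ∂Π(E) = 0`: space-time cycles project to cycles of the toric code.
[cite: DennisEtAl2002, §4.3 and §6.1] -/
theorem proj_mem_cycles_of_mem_stCycles [NeZero L] {E : History L T} (hE : E ∈ stCycles L T) :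
    E.proj ∈ cycles L := by
  show syn L E.proj = 0
  funext s
  rw [syn_proj_eq_sum_stSyn]
  have h0 : stSyn L T E = 0 := hE
  simp [h0]

/-- The projection has at most as many links as the history: `|Π(E)| ≤ |E|` (a link of `Π(E)` lies in
some slice of `E`). [cite: DennisEtAl2002, §6.1 (Π(E) ⊆ the horizontal links of E)] -/
theorem hammingNorm_proj_le [NeZero L] (E : History L T) : hammingNorm E.proj ≤ hammingNorm E := by
  classical
  -- forget the time coordinate: `g (ℓ, t) = ℓ` on horizontal links (vertical links go anywhere)
  let g : STLink L T → Edge L := Sum.elim Prod.fst fun _ => ((0 : Vertex L), (0 : Fin 2))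
  have hsub : supp E.proj ⊆ (supp E).image g := by
    intro ℓ hℓ
    have hℓ' : E.proj ℓ ≠ 0 := by simpa [supp] using hℓ
    have hex : ∃ t : Fin T, E (Sum.inl (ℓ, t)) ≠ 0 := by
      by_contra h
      push Not at h
      apply hℓ'
      simp only [History.proj, Finset.sum_apply, History.slice]
      exact Finset.sum_eq_zero fun t _ => h t
    obtain ⟨t, ht⟩ := hex
    exact Finset.mem_image.2 ⟨Sum.inl (ℓ, t), by simpa [supp] using ht, rfl⟩
  calc hammingNorm E.proj = (supp E.proj).card := rfl
    _ ≤ ((supp E).image g).card := Finset.card_le_card hsub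
    _ ≤ (supp E).card := Finset.card_image_le
    _ = hammingNorm E := rfl

/-! ### The harmless histories as a subspace, and the space-time distance `≥ L` -/

/-- The projection `Π` as a linear map `History → Chain`. [cite: DennisEtAl2002, §6.1 (Π)] -/
def projLin (L T : ℕ) : History L T →ₗ[ZMod 2] Chain L :=
  ∑ t : Fin T, LinearMap.funLeft (ZMod 2) (ZMod 2) fun ℓ : Edge L => (Sum.inl (ℓ, t) : STLink L T)

/-- `projLin` computes `History.proj`. [cite: DennisEtAl2002, §6.1 (Π)] -/
theorem projLin_apply (E : History L T) : projLin L T E = E.proj := by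
  simp only [projLin, LinearMap.sum_apply, History.proj]
  rfl

/-- **The harmless histories form a subspace**: the preimage under `Π` of the plaquette boundaries
(`stTrivial` as a `Submodule`). [cite: DennisEtAl2002, §4.3 (homologically trivial cycles: boundaries of surfaces form a group)] -/
def stHarmless (L T : ℕ) [NeZero L] : Submodule (ZMod 2) (History L T) :=
  (rowSpace (plaquetteMatrix L)).comap (projLin L T)

/-- Membership in `stHarmless` is membership in `stTrivial` (`Π(E) ∈ boundaries`).
[cite: DennisEtAl2002, §4.3] -/
theorem mem_stHarmless_iff [NeZero L] (E : History L T) :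
    E ∈ stHarmless L T ↔ E ∈ stTrivial L T := by
  simp only [stHarmless, Submodule.mem_comap, projLin_apply]
  rfl

/-- **Space-time distance `≥ L`**: a closed history whose projection is homologically non-trivial
has at least `L` links ("At a minimum, the homologically nontrivial (self-avoiding) path must contain
at least `L` horizontal links") — via the toric distance `cycle_weight_ge_holds` applied to `Π(E)`.
[cite: DennisEtAl2002, §5.2 (at least L horizontal links)] -/
theorem le_hammingNorm_of_stCycles [NeZero L] {E : History L T} (hE : stSyn L T E = 0)
    (hnot : E ∉ stHarmless L T) : L ≤ hammingNorm E := by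
  have hcyc : E.proj ∈ cycles L := proj_mem_cycles_of_mem_stCycles hE
  have hnb : E.proj ∉ boundaries L := by
    rwa [mem_stHarmless_iff] at hnot
  exact (cycle_weight_ge_holds L E.proj hcyc hnb).trans (hammingNorm_proj_le E)

/-! ### The space-time check graph has degree at most `10` -/

/-- At most one round `t` has `castSucc t = τ`. [folklore] -/
theorem card_filter_castSucc_le (τ : Fin (T + 1)) :
    (univ.filter fun t : Fin T => τ = t.castSucc).card ≤ 1 :=
  Finset.card_le_one.2 fun a ha b hb => by
    rw [Finset.mem_filter] at ha hb
    exact Fin.castSucc_injective _ (ha.2.symm.trans hb.2)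

/-- At most one round `t` has `succ t = τ`. [folklore] -/
theorem card_filter_succ_le (τ : Fin (T + 1)) :
    (univ.filter fun t : Fin T => τ = t.succ).card ≤ 1 :=
  Finset.card_le_one.2 fun a ha b hb => by
    rw [Finset.mem_filter] at ha hb
    exact Fin.succ_injective _ (ha.2.symm.trans hb.2)

/-- At most two vertical links of a site column end at a given slice. [folklore] -/
theorem card_filter_castSucc_or_succ_le (τ : Fin (T + 1)) :
    (univ.filter fun t : Fin T => τ = t.castSucc ∨ τ = t.succ).card ≤ 2 := by
  rw [Finset.filter_or]
  exact (Finset.card_union_le _ _).trans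
    (Nat.add_le_add (card_filter_castSucc_le τ) (card_filter_succ_le τ))

/-- **Row weight `≤ 6`**: a space-time site `(s, τ)` lies on at most `4` horizontal links of its slice
and on at most `2` vertical links. [cite: DennisEtAl2002, §4.2 (simple cubic lattice: 4 spacelike + 2 timelike links at each site)] -/
theorem card_row_stMatrix_le [NeZero L] (x : STSite L T) :
    (univ.filter fun ℓ : STLink L T => stMatrix L T x ℓ ≠ 0).card ≤ 6 := by
  classical
  obtain ⟨s, τ⟩ := x
  set A : Finset (Edge L × Fin T) :=
    (univ.filter fun e : Edge L => starMatrix L s e ≠ 0) ×ˢ (univ.filter fun t : Fin T => τ = t.castSucc)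
    with hA
  set B : Finset (Vertex L × Fin T) :=
    ({s} : Finset (Vertex L)) ×ˢ (univ.filter fun t : Fin T => τ = t.castSucc ∨ τ = t.succ) with hB
  have hsub : (univ.filter fun ℓ : STLink L T => stMatrix L T (s, τ) ℓ ≠ 0) ⊆
      A.map Function.Embedding.inl ∪ B.map Function.Embedding.inr := by
    intro ℓ hℓ
    rw [Finset.mem_filter] at hℓ
    rcases ℓ with ⟨e, t⟩ | ⟨w, t⟩
    · have h := hℓ.2
      simp only [stMatrix, Matrix.of_apply, Sum.elim_inl] at h
      refine Finset.mem_union_left _ (Finset.mem_map.2 ⟨(e, t), ?_, rfl⟩)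
      rw [hA, Finset.mem_product, Finset.mem_filter, Finset.mem_filter]
      by_cases hτ : τ = t.castSucc
      · rw [if_pos hτ] at h
        exact ⟨⟨Finset.mem_univ _, h⟩, ⟨Finset.mem_univ _, hτ⟩⟩
      · rw [if_neg hτ] at h
        exact absurd rfl h
    · have h := hℓ.2
      simp only [stMatrix, Matrix.of_apply, Sum.elim_inr] at h
      refine Finset.mem_union_right _ (Finset.mem_map.2 ⟨(w, t), ?_, rfl⟩)
      rw [hB, Finset.mem_product, Finset.mem_singleton, Finset.mem_filter]
      by_cases hc : s = w ∧ (τ = t.castSucc ∨ τ = t.succ)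
      · exact ⟨hc.1.symm, Finset.mem_univ _, hc.2⟩
      · rw [if_neg hc] at h
        exact absurd rfl h
  refine (Finset.card_le_card hsub).trans ((Finset.card_union_le _ _).trans ?_)
  rw [Finset.card_map, Finset.card_map, hA, hB, Finset.card_product, Finset.card_product,
    Finset.card_singleton]
  have h1 := ToricCluster.card_row_starMatrix_le (L := L) s
  have h2 := card_filter_castSucc_le (T := T) τ
  have h3 := card_filter_castSucc_or_succ_le (T := T) τ
  calc (univ.filter fun e : Edge L => starMatrix L s e ≠ 0).card *
        (univ.filter fun t : Fin T => τ = t.castSucc).card +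
        1 * (univ.filter fun t : Fin T => τ = t.castSucc ∨ τ = t.succ).card
      ≤ 4 * 1 + 1 * 2 := by gcongr
    _ = 6 := by norm_num

/-- **Column weight `≤ 2`**: every space-time link meets at most `2` sites (a horizontal link its two
ends in its slice, a vertical link the sites below and above). [cite: DennisEtAl2002, §4.2 (links of the spacetime lattice)] -/
theorem card_col_stMatrix_le [NeZero L] (ℓ : STLink L T) :
    (univ.filter fun x : STSite L T => stMatrix L T x ℓ ≠ 0).card ≤ 2 := by
  classical
  rcases ℓ with ⟨e, t⟩ | ⟨w, t⟩
  · have hsub : (univ.filter fun x : STSite L T => stMatrix L T x (Sum.inl (e, t)) ≠ 0) ⊆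
        (univ.filter fun s : Vertex L => starMatrix L s e ≠ 0) ×ˢ ({t.castSucc} : Finset (Fin (T + 1))) := by
      intro x hx
      rw [Finset.mem_filter] at hx
      have h := hx.2
      simp only [stMatrix, Matrix.of_apply, Sum.elim_inl] at h
      rw [Finset.mem_product, Finset.mem_filter, Finset.mem_singleton]
      by_cases hτ : x.2 = t.castSucc
      · rw [if_pos hτ] at h
        exact ⟨⟨Finset.mem_univ _, h⟩, hτ⟩
      · rw [if_neg hτ] at h
        exact absurd rfl h
    refine (Finset.card_le_card hsub).trans ?_
    rw [Finset.card_product, Finset.card_singleton, mul_one]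
    exact ToricCluster.card_col_starMatrix_le (L := L) e
  · have hsub : (univ.filter fun x : STSite L T => stMatrix L T x (Sum.inr (w, t)) ≠ 0) ⊆
        ({w} : Finset (Vertex L)) ×ˢ ({t.castSucc, t.succ} : Finset (Fin (T + 1))) := by
      intro x hx
      rw [Finset.mem_filter] at hx
      have h := hx.2
      simp only [stMatrix, Matrix.of_apply, Sum.elim_inr] at h
      rw [Finset.mem_product, Finset.mem_singleton, Finset.mem_insert, Finset.mem_singleton]
      by_cases hc : x.1 = w ∧ (x.2 = t.castSucc ∨ x.2 = t.succ)
      · exact hc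
      · rw [if_neg hc] at h
        exact absurd rfl h
    refine (Finset.card_le_card hsub).trans ?_
    rw [Finset.card_product, Finset.card_singleton, one_mul]
    exact Finset.card_le_two

/-- **The space-time check graph has maximal degree `≤ 10`** (`c(w-1)` with row weight `w = 6`,
column weight `c = 2`; lit-2's `degree_checkGraph_le`). [cite: Gottesman2014, §4 (degree z = (r-1)c)] -/
theorem degree_stGraph_le [NeZero L] [DecidableRel (checkGraph (stMatrix L T)).Adj]
    (ℓ : STLink L T) : (checkGraph (stMatrix L T)).degree ℓ ≤ 10 := by
  have := degree_checkGraph_le (stMatrix L T) (w := 6) (c := 2) card_row_stMatrix_le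
    card_col_stMatrix_le ℓ
  simpa using this

end PhenomCluster

end Summit.Ventures.QEC.Thresholds

end
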